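import Literature.Topology.FourManifolds.SimplifiedBrokenLefschetzFibration
import Literature.Topology.FourManifolds.SmoothOrientationGluing

/-!
# SmoothPoincare4 / SblfDescent — crux `StepTwo`, line `Sketch`: stub `stub_sblfTransport`

Simplified broken Lefschetz fibrations (the tree's structure
`Literature.Topology.FourManifolds.IsSimplifiedBrokenLefschetzFibration o f L h`) transport along
diffeomorphisms: if `Φ : X ≅ Y` is a `C^∞` diffeomorphism of 4-manifolds and `f : Y → S²` is an SBLF of
lower genus `h` for the orientation `o` with positive Lefschetz set `L`, then `f ∘ Φ` is an SBLF of lower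
genus `h` on `X` for the pulled-back orientation `Φ^* o` (`SmoothOrientation.comap`, which makes `Φ`
orientation preserving) with Lefschetz set `Φ ⁻¹ L`.  Every clause is carried by the chain rule
(`d(f ∘ Φ)_p = df_{Φ p} ∘ dΦ_p` with `dΦ_p` onto), by precomposing the Lefschetz / fold charts with `Φ`
(`Homeomorph.transOpenPartialHomeomorph`), and by the homeomorphism of fibres `(f ∘ Φ)⁻¹(y) ≅ f⁻¹(y)`
(isomorphic `H₁`, `singularHomology.mapIso`).  Folklore (Baykur–Kamada 2015, §2: fibrations are
considered up to `f ↦ f ∘ ψ`); this is the registered stub `stub_sblfTransport` of the lead skeleton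
`Cruxes/StepTwo/Lines/Sketch.lean` of crux item stmt-SmoothPoincare4-18529.
-/

noncomputable section

-- the prescribed namespace `Summit.<P>.<Sub>.…` duplicates `SmoothPoincare4` (P = Sub)
set_option linter.dupNamespace false

namespace Summit.SmoothPoincare4.SmoothPoincare4.Theorems

open scoped Manifold ContDiff Topology ContinuousMap
open Set Function Literature.Topology.FourManifolds

variable {X Y : Type} [TopologicalSpace X] [ChartedSpace (EuclideanSpace ℝ (Fin 4)) X]
  [TopologicalSpace Y] [ChartedSpace (EuclideanSpace ℝ (Fin 4)) Y]

/-- The differential of a diffeomorphism is onto at every point of the form `Φ⁻¹ q`: by the chain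
rule `dΦ ∘ d(Φ⁻¹) = d(id) = id` at `q`. [folklore] -/
theorem sblfTransport_surjective_mfderiv_symm_apply (Φ : X ≃ₘ⟮𝓡 4, 𝓡 4⟯ Y) (q : Y) :
    Surjective (mfderiv (𝓡 4) (𝓡 4) Φ (Φ.symm q)) := by
  have h1 : MDifferentiableAt (𝓡 4) (𝓡 4) Φ (Φ.symm q) := Φ.mdifferentiable (by simp) _
  have h2 : MDifferentiableAt (𝓡 4) (𝓡 4) Φ.symm q := Φ.symm.mdifferentiable (by simp) _
  have hc : mfderiv (𝓡 4) (𝓡 4) ((Φ : X → Y) ∘ Φ.symm) q =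
      (mfderiv (𝓡 4) (𝓡 4) Φ (Φ.symm q)).comp (mfderiv (𝓡 4) (𝓡 4) Φ.symm q) :=
    mfderiv_comp q h1 h2
  have hid : ((Φ : X → Y) ∘ Φ.symm) = id := funext fun y => Φ.apply_symm_apply y
  rw [hid, mfderiv_id] at hc
  intro v
  refine ⟨mfderiv (𝓡 4) (𝓡 4) Φ.symm q v, ?_⟩
  have hv := congrArg (fun T : TangentSpace (𝓡 4) q →L[ℝ] TangentSpace (𝓡 4) q => T v) hc
  exact hv.symm

/-- The differential of a diffeomorphism is onto at every point. [folklore] -/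
theorem sblfTransport_surjective_mfderiv (Φ : X ≃ₘ⟮𝓡 4, 𝓡 4⟯ Y) (p : X) :
    Surjective (mfderiv (𝓡 4) (𝓡 4) Φ p) := by
  have key := sblfTransport_surjective_mfderiv_symm_apply Φ (Φ p)
  rw [Φ.symm_apply_apply] at key
  exact key

/-- **Regular points transport**: for a diffeomorphism `Φ` and a differentiable `f`, the
differential of `f ∘ Φ` at `p` is onto iff the differential of `f` at `Φ p` is (chain rule,
`dΦ_p` onto). [folklore] -/
theorem sblfTransport_surjective_mfderiv_comp_iff (Φ : X ≃ₘ⟮𝓡 4, 𝓡 4⟯ Y)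
    {f : Y → Metric.sphere (0 : EuclideanSpace ℝ (Fin 3)) 1}
    (hf : MDifferentiable (𝓡 4) (𝓡 2) f) (p : X) :
    Surjective (mfderiv (𝓡 4) (𝓡 2) (f ∘ Φ) p) ↔
      Surjective (mfderiv (𝓡 4) (𝓡 2) f (Φ p)) := by
  have hΦ : MDifferentiableAt (𝓡 4) (𝓡 4) Φ p := Φ.mdifferentiable (by simp) p
  have hc : mfderiv (𝓡 4) (𝓡 2) (f ∘ Φ) p =
      (mfderiv (𝓡 4) (𝓡 2) f (Φ p)).comp (mfderiv (𝓡 4) (𝓡 4) Φ p) :=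
    mfderiv_comp p (hf (Φ p)) hΦ
  rw [hc]
  change Surjective ((mfderiv (𝓡 4) (𝓡 2) f (Φ p)) ∘ (mfderiv (𝓡 4) (𝓡 4) Φ p)) ↔ _
  exact ⟨fun h => Surjective.of_comp h,
    fun h => h.comp (sblfTransport_surjective_mfderiv Φ p)⟩

/-- **Regular values transport**: `y` is a regular value of `f ∘ Φ` iff it is one of `f`.
[folklore] -/
theorem sblfTransport_regularValue_iff (Φ : X ≃ₘ⟮𝓡 4, 𝓡 4⟯ Y)
    {f : Y → Metric.sphere (0 : EuclideanSpace ℝ (Fin 3)) 1}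
    (hf : MDifferentiable (𝓡 4) (𝓡 2) f) (y : Metric.sphere (0 : EuclideanSpace ℝ (Fin 3)) 1) :
    (∀ q, (f ∘ Φ) q = y → Surjective (mfderiv (𝓡 4) (𝓡 2) (f ∘ Φ) q)) ↔
      (∀ q, f q = y → Surjective (mfderiv (𝓡 4) (𝓡 2) f q)) := by
  constructor
  · intro hy q hq
    have h := hy (Φ.symm q) (by simpa using hq)
    rwa [sblfTransport_surjective_mfderiv_comp_iff Φ hf, Φ.apply_symm_apply] at h
  · intro hy q hq
    rw [sblfTransport_surjective_mfderiv_comp_iff Φ hf]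
    exact hy (Φ q) hq

/-- **Fibre genus transports**: the fibres `(f ∘ Φ)⁻¹(y)` and `f⁻¹(y)` are homeomorphic via `Φ`,
so `H₁((f ∘ Φ)⁻¹(y); ℤ) ≅ ℤ^{2n}` as soon as `H₁(f⁻¹(y); ℤ) ≅ ℤ^{2n}` (homeomorphism invariance of
singular homology, `singularHomology.mapIso`). [folklore] -/
theorem sblfTransport_genus (Φ : X ≃ₘ⟮𝓡 4, 𝓡 4⟯ Y)
    (f : Y → Metric.sphere (0 : EuclideanSpace ℝ (Fin 3)) 1)
    (y : Metric.sphere (0 : EuclideanSpace ℝ (Fin 3)) 1) (n : ℕ)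
    (hG : Nonempty ((Fin (2 * n) → ℤ) ≃ₗ[ℤ]
      Literature.AlgebraicTopology.SingularHomology.singularHomology ℤ ℤ ↥(f ⁻¹' {y}) 1)) :
    Nonempty ((Fin (2 * n) → ℤ) ≃ₗ[ℤ]
      Literature.AlgebraicTopology.SingularHomology.singularHomology ℤ ℤ ↥((f ∘ Φ) ⁻¹' {y}) 1) := by
  obtain ⟨e⟩ := hG
  let η : ↥((f ∘ Φ) ⁻¹' {y}) ≃ₜ ↥(f ⁻¹' {y}) :=
    Φ.toHomeomorph.subtype (p := fun x => x ∈ (f ∘ Φ) ⁻¹' {y}) (q := fun x => x ∈ f ⁻¹' {y})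
      fun _ => Iff.rfl
  exact ⟨e.trans
    (Literature.AlgebraicTopology.SingularHomology.singularHomology.mapIso ℤ ℤ η 1).symm.toLinearEquiv⟩

variable [IsManifold (𝓡 4) ∞ X] [IsManifold (𝓡 4) ∞ Y]

/-- **Lefschetz critical points transport**: if `Φ p` is a positive Lefschetz critical point of `f`
for `o`, then `p` is a positive Lefschetz critical point of `f ∘ Φ` for the pulled-back orientation
`Φ^* o`: precompose the Lefschetz chart with `Φ`; its Jacobian at `p` is `d(φ)_{Φ p} ∘ dΦ_p`, and the
sign of `det dΦ_p` is exactly what `SmoothOrientation.comap` compensates. [folklore] -/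
theorem sblfTransport_isLefschetzCriticalPoint (Φ : X ≃ₘ⟮𝓡 4, 𝓡 4⟯ Y)
    {o : SmoothOrientation (𝓡 4) Y} {f : Y → Metric.sphere (0 : EuclideanSpace ℝ (Fin 3)) 1} {p : X}
    (hp : IsLefschetzCriticalPoint (𝓡 4) (𝓡 2) o f (Φ p) true) :
    IsLefschetzCriticalPoint (𝓡 4) (𝓡 2) (o.comap Φ (by simp)) (f ∘ Φ) p true := by
  obtain ⟨c, hc⟩ := hp
  have hc' : c.IsPositive o := by simpa using hc
  let c' : LefschetzChart (𝓡 4) (𝓡 2) (f ∘ Φ) p :=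
    { φ := Φ.toHomeomorph.transOpenPartialHomeomorph c.φ
      ψ := c.ψ
      mem_source := by simpa using c.mem_source
      apply_eq_zero := by simpa using c.apply_eq_zero
      mapsTo := fun q hq => c.mapsTo (by simpa using hq)
      contMDiffOn := by
        rw [Homeomorph.transOpenPartialHomeomorph_source, Homeomorph.transOpenPartialHomeomorph_apply,
          Diffeomorph.coe_toHomeomorph]
        exact c.contMDiffOn.comp Φ.contMDiff.contMDiffOn fun q hq => hq
      contMDiffOn_symm := by
        rw [Homeomorph.transOpenPartialHomeomorph_target,
          Homeomorph.transOpenPartialHomeomorph_symm_apply, Diffeomorph.coe_toHomeomorph_symm]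
        exact Φ.symm.contMDiff.comp_contMDiffOn c.contMDiffOn_symm
      contMDiffOn_base := c.contMDiffOn_base
      contMDiffOn_base_symm := c.contMDiffOn_base_symm
      node_eq := fun q hq => c.node_eq (Φ q) (by simpa using hq) }
  refine ⟨c', ?_⟩
  simp only [iff_true]
  rw [LefschetzChart.isPositive_iff] at hc' ⊢
  have hmf : mfderiv (𝓡 4) (𝓡 4) c'.φ p =
      (mfderiv (𝓡 4) (𝓡 4) c.φ (Φ p)).comp (mfderiv (𝓡 4) (𝓡 4) Φ p) := by
    have heq : (c'.φ : X → EuclideanSpace ℝ (Fin 4)) = c.φ ∘ Φ := by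
      simp [c']
    rw [heq]
    exact mfderiv_comp p (c.contMDiffAt.mdifferentiableAt (by simp)) (Φ.mdifferentiable (by simp) p)
  have hdet : LinearMap.det (M := EuclideanSpace ℝ (Fin 4)) (mfderiv (𝓡 4) (𝓡 4) c'.φ p).toLinearMap =
      LinearMap.det (M := EuclideanSpace ℝ (Fin 4)) (mfderiv (𝓡 4) (𝓡 4) c.φ (Φ p)).toLinearMap *
        LinearMap.det (M := EuclideanSpace ℝ (Fin 4)) (mfderiv (𝓡 4) (𝓡 4) Φ p).toLinearMap := by
    rw [hmf]
    exact LinearMap.det_comp (M := EuclideanSpace ℝ (Fin 4))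
      (mfderiv (𝓡 4) (𝓡 4) c.φ (Φ p)).toLinearMap (mfderiv (𝓡 4) (𝓡 4) Φ p).toLinearMap
  have hA : LinearMap.det (M := EuclideanSpace ℝ (Fin 4))
      (mfderiv (𝓡 4) (𝓡 4) c.φ (Φ p)).toLinearMap ≠ 0 := c.det_mfderiv_ne_zero
  have hB : LinearMap.det (M := EuclideanSpace ℝ (Fin 4))
      (mfderiv (𝓡 4) (𝓡 4) Φ p).toLinearMap ≠ 0 := Φ.det_mfderiv_ne_zero (by simp) p
  have hφp : c'.φ p = c.φ (Φ p) := by simp [c']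
  rw [hdet, SmoothOrientation.comap_apply]
  by_cases hBpos : 0 < LinearMap.det (M := EuclideanSpace ℝ (Fin 4))
      (mfderiv (𝓡 4) (𝓡 4) Φ p).toLinearMap
  · rw [if_pos hBpos, mul_pos_iff_of_pos_right hBpos]
    exact hc'
  · have hBneg : LinearMap.det (M := EuclideanSpace ℝ (Fin 4))
        (mfderiv (𝓡 4) (𝓡 4) Φ p).toLinearMap < 0 := lt_of_le_of_ne (not_lt.mp hBpos) hB
    rw [if_neg hBpos, LefschetzChart.euclideanOrientation_eq_neg_iff, hc']
    constructor
    · intro hna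
      exact mul_pos_of_neg_of_neg (lt_of_le_of_ne (not_lt.mp hna) hA) hBneg
    · intro hab ha
      exact absurd hab (not_lt.mpr (mul_nonpos_of_nonneg_of_nonpos ha.le hBneg.le))

/-- **Simplified broken Lefschetz fibrations transport along diffeomorphisms.**  For a `C^∞`
diffeomorphism `Φ : X ≅ Y` of 4-manifolds and an SBLF `f : Y → S²` of lower genus `h` for the
orientation `o` with positive Lefschetz set `L` (`IsSimplifiedBrokenLefschetzFibration o f L h`),
the composite `f ∘ Φ` is an SBLF of lower genus `h` on `X` for the pulled-back orientation
`Φ^* o = o.comap Φ` with Lefschetz set `Φ ⁻¹ L` (`L.preimage Φ`): smoothness and surjectivity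
compose; Lefschetz charts transport with their chirality (`sblfTransport_isLefschetzCriticalPoint`);
fold charts precompose with `Φ`; the critical set of `f ∘ Φ` is `Φ⁻¹` of that of `f`
(`sblfTransport_surjective_mfderiv_comp_iff`), so the round locus is the homeomorphic preimage of a
connected set and `f ∘ Φ` is injective on it; regular values agree
(`sblfTransport_regularValue_iff`) and fibres are homeomorphic, hence have the same `H₁`
(`sblfTransport_genus`).  Baykur–Kamada 2015, §2 (fibrations up to `f ∘ ψ`); folklore. -/
theorem sblf_comp_diffeomorph (Φ : X ≃ₘ⟮𝓡 4, 𝓡 4⟯ Y) {o : SmoothOrientation (𝓡 4) Y}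
    {f : Y → Metric.sphere (0 : EuclideanSpace ℝ (Fin 3)) 1} {L : Finset Y} {h : ℕ}
    (hf : IsSimplifiedBrokenLefschetzFibration o f L h) :
    IsSimplifiedBrokenLefschetzFibration (o.comap Φ (by simp)) (f ∘ Φ)
      (L.preimage Φ Φ.injective.injOn) h := by
  have hfd : MDifferentiable (𝓡 4) (𝓡 2) f := hf.contMDiff.mdifferentiable (by simp)
  refine
    { contMDiff := hf.contMDiff.comp Φ.contMDiff
      surjective := hf.surjective.comp Φ.surjective
      lefschetz := ?_
      fold := ?_
      isConnected_round := ?_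
      injOn_crit := ?_
      fibre := ?_
      exists_higher := ?_
      exists_lower := ?_
      lefschetz_higher := ?_ }
  · -- Lefschetz points
    intro p hp
    rw [Finset.mem_preimage] at hp
    exact sblfTransport_isLefschetzCriticalPoint Φ (hf.lefschetz (Φ p) hp)
  · -- fold charts
    intro p hR hpL
    have hR' : ¬ Surjective (mfderiv (𝓡 4) (𝓡 2) f (Φ p)) := by
      rwa [← sblfTransport_surjective_mfderiv_comp_iff Φ hfd]
    have hpL' : Φ p ∉ L := by rwa [Finset.mem_preimage] at hpL
    obtain ⟨φ, ψ, hmem, h0, hmaps, hφ, hφs, hψ, hψs, heq⟩ := hf.fold (Φ p) hR' hpL'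
    refine ⟨Φ.toHomeomorph.transOpenPartialHomeomorph φ, ψ, ?_, ?_, ?_, ?_, ?_, hψ, hψs, ?_⟩
    · simpa using hmem
    · simpa using h0
    · intro q hq
      exact hmaps (by simpa using hq)
    · rw [Homeomorph.transOpenPartialHomeomorph_source, Homeomorph.transOpenPartialHomeomorph_apply,
        Diffeomorph.coe_toHomeomorph]
      exact hφ.comp Φ.contMDiff.contMDiffOn fun q hq => hq
    · rw [Homeomorph.transOpenPartialHomeomorph_target,
        Homeomorph.transOpenPartialHomeomorph_symm_apply, Diffeomorph.coe_toHomeomorph_symm]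
      exact Φ.symm.contMDiff.comp_contMDiffOn hφs
    · intro q hq
      simpa using heq (Φ q) (by simpa using hq)
  · -- round locus connected and non-empty
    have hset : {p : X | ¬ Surjective (mfderiv (𝓡 4) (𝓡 2) (f ∘ Φ) p)} \
        (↑(L.preimage Φ Φ.injective.injOn) : Set X) =
        Φ.toHomeomorph ⁻¹' ({q : Y | ¬ Surjective (mfderiv (𝓡 4) (𝓡 2) f q)} \ (↑L : Set Y)) := by
      ext p
      simp only [mem_sdiff, mem_setOf_eq, Finset.coe_preimage, mem_preimage, Finset.mem_coe,
        Diffeomorph.coe_toHomeomorph, sblfTransport_surjective_mfderiv_comp_iff Φ hfd]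
    rw [hset]
    exact Φ.toHomeomorph.isConnected_preimage.mpr hf.isConnected_round
  · -- injective on the critical set
    intro p hp q hq hpq
    have hp' : ¬ Surjective (mfderiv (𝓡 4) (𝓡 2) f (Φ p)) := by
      rwa [← sblfTransport_surjective_mfderiv_comp_iff Φ hfd]
    have hq' : ¬ Surjective (mfderiv (𝓡 4) (𝓡 2) f (Φ q)) := by
      rwa [← sblfTransport_surjective_mfderiv_comp_iff Φ hfd]
    exact Φ.injective (hf.injOn_crit hp' hq' hpq)
  · -- regular fibres: connected, genus h + 1 or h
    intro y hy
    have hy' := (sblfTransport_regularValue_iff Φ hfd y).mp hy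
    obtain ⟨hconn, hG⟩ := hf.fibre y hy'
    refine ⟨?_, hG.imp (sblfTransport_genus Φ f y (h + 1)) (sblfTransport_genus Φ f y h)⟩
    have hpre : (f ∘ Φ) ⁻¹' {y} = Φ.toHomeomorph ⁻¹' (f ⁻¹' {y}) := by
      rw [preimage_comp, Diffeomorph.coe_toHomeomorph]
    rw [hpre]
    exact Φ.toHomeomorph.isConnected_preimage.mpr hconn
  · -- a higher-genus regular fibre
    obtain ⟨y, hy, hG⟩ := hf.exists_higher
    exact ⟨y, (sblfTransport_regularValue_iff Φ hfd y).mpr hy, sblfTransport_genus Φ f y (h + 1) hG⟩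
  · -- a lower-genus regular fibre
    obtain ⟨y, hy, hG⟩ := hf.exists_lower
    exact ⟨y, (sblfTransport_regularValue_iff Φ hfd y).mpr hy, sblfTransport_genus Φ f y h hG⟩
  · -- Lefschetz points on the higher side
    intro p hp
    rw [Finset.mem_preimage] at hp
    have hev := hf.lefschetz_higher (Φ p) hp
    refine hev.mono fun y hy hreg => ?_
    exact sblfTransport_genus Φ f y (h + 1) (hy ((sblfTransport_regularValue_iff Φ hfd y).mp hreg))

/-- **Stub `stub_sblfTransport` of line Sketch (crux `StepTwo`, stmt-SmoothPoincare4-18529).**  If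
`X` and `Y` are diffeomorphic smooth 4-manifolds and `Y` carries a simplified broken Lefschetz
fibration of lower genus `h`, so does `X` (`sblf_comp_diffeomorph`: pull back the orientation,
precompose `f`, pull back the Lefschetz set).  Registered signature, verbatim. [folklore] -/
theorem stub_sblfTransport :
    ∀ (X Y : Type) [TopologicalSpace X] [T2Space X] [SecondCountableTopology X]
      [ChartedSpace (EuclideanSpace ℝ (Fin 4)) X] [IsManifold (𝓡 4) ((⊤ : ℕ∞) : WithTop ℕ∞) X]
      [TopologicalSpace Y] [T2Space Y] [SecondCountableTopology Y]
      [ChartedSpace (EuclideanSpace ℝ (Fin 4)) Y] [IsManifold (𝓡 4) ((⊤ : ℕ∞) : WithTop ℕ∞) Y]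
      (h : ℕ),
      Nonempty (Diffeomorph (𝓡 4) (𝓡 4) X Y ((⊤ : ℕ∞) : WithTop ℕ∞)) →
      (∃ (o : Literature.Topology.FourManifolds.SmoothOrientation (𝓡 4) Y)
          (f : Y → Metric.sphere (0 : EuclideanSpace ℝ (Fin 3)) 1) (L : Finset Y),
          Literature.Topology.FourManifolds.IsSimplifiedBrokenLefschetzFibration o f L h) →
      ∃ (o : Literature.Topology.FourManifolds.SmoothOrientation (𝓡 4) X)
        (f : X → Metric.sphere (0 : EuclideanSpace ℝ (Fin 3)) 1) (L : Finset X),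
        Literature.Topology.FourManifolds.IsSimplifiedBrokenLefschetzFibration o f L h := by
  intro X Y _ _ _ _ _ _ _ _ _ _ h hΦ hY
  obtain ⟨Φ⟩ := hΦ
  obtain ⟨o, f, L, hf⟩ := hY
  exact ⟨_, _, _, sblf_comp_diffeomorph Φ hf⟩

end Summit.SmoothPoincare4.SmoothPoincare4.Theorems

end
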